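import Literature.NumberTheory.EllipticCurves.BSDSelmerParityDokchitserTowerProofs
import HarnessLib

/-!
# X3, the DEGENERATE rows OFF the sub-locus: an ADDITIVE CHARACTER OF THE FIRST LAYER GROUP that dies
# deep in the `ℤ_p`-tower is a multiple of the LAYER CHARACTER (cell `bsd-eis`, seat `bsd-eis-x3` gen 7;
# STEP 2 of the independence argument F5 for the layer T-side classes, MEMO-9 §2.4 (f); route K1
# `AdditiveBranchIMC`, crux `GordTwoRankZeroOffCaseOne` — supports only)

HONEST FRAMING (`run/shared/lean/pub/bsd-eis/README.md` §4): THEOREMS ONLY (no `def`, no named fact,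
no `sorry`); nothing is booked; no label, tier or count of record moves.

## What

`κ : ZpExtension K p`, `γ` a topological generator (`κ γ = 1`), `L_n = κ.layerSubgroup n = κ⁻¹(pⁿℤ_p)`;
`ψ : Γ_K → ℤ/p` ADDITIVE ON `L₁`. The tower lemma `ZpExtension.exists_layerSubgroup_succ_mul_pow`
(`L_n = ⋃_j L_{n+1}·(γ^{pⁿ})^j`) gives:
* `addCharOn_pow` — `ψ(x^k) = k·ψ(x)` for `x ∈ L₁`;
* `addCharOn_eq_zero_of_succ` — for `n ≥ 1`, `ψ` vanishing on `L_{n+2}` vanishes on `L_{n+1}`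
  (`ψ((γ^{p^{n+1}})^j) = j·p·ψ(γ^{pⁿ}) = 0`);
* `addCharOn_eq_zero_layer_two` — if `ψ` vanishes on some `L_m`, `m ≥ 2`, it vanishes on `L₂`;
* `addCharOn_eq_mul_of_layer_two` — then on `L₁`: `ψ(σ) = j·ψ(γ^p)` where `σ = h·(γ^p)^j`, `h ∈ L₂` —
  i.e. `ψ` is the multiple `ψ(γ^p)` of the layer character `σ ↦ j (mod p)`.
(STEP 1 — a locally constant `ψ` vanishing on `ker κ` vanishes on some `L_m` — and STEPS 3–4 are the
successor's.)
References: [Washington1997] §13.1; [SerreLocalFields1979] Ch. X §3.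
-/

set_option autoImplicit false

namespace Summit.BirchSwinnertonDyer.Rank1Residual.Additive

namespace LayerCharTower

open Field Literature.NumberTheory.EllipticCurves

variable {K : Type} [Field K] {p : ℕ} [Fact p.Prime] (κ : ZpExtension K p)

/-- `ψ(1) = 0` for `ψ` additive on `L₁`. [folklore] -/
theorem addCharOn_one {ψ : absoluteGaloisGroup K → ZMod p}
    (hψ : ∀ a ∈ κ.layerSubgroup 1, ∀ b ∈ κ.layerSubgroup 1, ψ (a * b) = ψ a + ψ b) : ψ 1 = 0 := by
  have h := hψ 1 (κ.layerSubgroup 1).one_mem 1 (κ.layerSubgroup 1).one_mem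
  rw [mul_one] at h
  -- `ψ 1 = ψ 1 + ψ 1`
  have : ψ 1 + ψ 1 = ψ 1 + 0 := by rw [add_zero]; exact h.symm
  exact add_left_cancel this

/-- **`ψ(x^k) = k·ψ(x)`** for `x ∈ L₁` and `ψ` additive on `L₁`. [folklore] -/
theorem addCharOn_pow {ψ : absoluteGaloisGroup K → ZMod p}
    (hψ : ∀ a ∈ κ.layerSubgroup 1, ∀ b ∈ κ.layerSubgroup 1, ψ (a * b) = ψ a + ψ b)
    {x : absoluteGaloisGroup K} (hx : x ∈ κ.layerSubgroup 1) (k : ℕ) :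
    ψ (x ^ k) = (k : ZMod p) * ψ x := by
  induction k with
  | zero => rw [pow_zero, addCharOn_one κ hψ, Nat.cast_zero, zero_mul]
  | succ k ih =>
    rw [pow_succ, hψ _ ((κ.layerSubgroup 1).pow_mem hx k) _ hx, ih, Nat.cast_succ]
    ring

/-- `γ^{pⁿ} ∈ L_n` for a topological generator `γ`. [cite: Washington1997, §13.1] -/
theorem pow_mem_layerSubgroup {γ : absoluteGaloisGroup K} (hγ : κ.IsTopGenerator γ) (n : ℕ) :
    γ ^ p ^ n ∈ κ.layerSubgroup n := by
  rw [ZpExtension.mem_layerSubgroup, map_pow, show κ γ = Multiplicative.ofAdd 1 from hγ, ← ofAdd_nsmul,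
    toAdd_ofAdd, nsmul_eq_mul, mul_one]
  exact ⟨1, by push_cast; ring⟩

/-- **One step down the tower**: for `n ≥ 1`, if `ψ` (additive on `L₁`) vanishes on `L_{n+2}` then it
vanishes on `L_{n+1}`: every `σ ∈ L_{n+1}` is `h·(γ^{p^{n+1}})^j` with `h ∈ L_{n+2}`, and
`ψ((γ^{p^{n+1}})^j) = j·p·ψ(γ^{pⁿ}) = 0` (`γ^{pⁿ} ∈ L_n ≤ L₁`). [cite: Washington1997, §13.1] -/
theorem addCharOn_eq_zero_of_succ {ψ : absoluteGaloisGroup K → ZMod p}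
    (hψ : ∀ a ∈ κ.layerSubgroup 1, ∀ b ∈ κ.layerSubgroup 1, ψ (a * b) = ψ a + ψ b)
    {γ : absoluteGaloisGroup K} (hγ : κ.IsTopGenerator γ) {n : ℕ} (hn : 1 ≤ n)
    (hvan : ∀ σ ∈ κ.layerSubgroup (n + 2), ψ σ = 0) :
    ∀ σ ∈ κ.layerSubgroup (n + 1), ψ σ = 0 := by
  intro σ hσ
  obtain ⟨h, j, hj⟩ := κ.exists_layerSubgroup_succ_mul_pow hγ (n + 1) ⟨σ, hσ⟩
  change σ = (h : absoluteGaloisGroup K) * (γ ^ p ^ (n + 1)) ^ j at hj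
  have hγn1 : γ ^ p ^ n ∈ κ.layerSubgroup 1 := κ.layerSubgroup_antitone hn (pow_mem_layerSubgroup κ hγ n)
  have hγs : γ ^ p ^ (n + 1) = (γ ^ p ^ n) ^ p := by rw [pow_succ, pow_mul]
  have hγs1 : γ ^ p ^ (n + 1) ∈ κ.layerSubgroup 1 := by
    rw [hγs]; exact (κ.layerSubgroup 1).pow_mem hγn1 p
  have hh1 : (h : absoluteGaloisGroup K) ∈ κ.layerSubgroup 1 :=
    κ.layerSubgroup_antitone (by omega) h.2
  rw [hj, hψ _ hh1 _ ((κ.layerSubgroup 1).pow_mem hγs1 j), hvan _ h.2, zero_add,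
    addCharOn_pow κ hψ hγs1, hγs, addCharOn_pow κ hψ hγn1, ZMod.natCast_self, zero_mul, mul_zero]

/-- **Down to the second layer**: if `ψ` (additive on `L₁`) vanishes on `L_{m+2}` then it vanishes on
`L₂`. [cite: Washington1997, §13.1] -/
theorem addCharOn_eq_zero_layer_two {ψ : absoluteGaloisGroup K → ZMod p}
    (hψ : ∀ a ∈ κ.layerSubgroup 1, ∀ b ∈ κ.layerSubgroup 1, ψ (a * b) = ψ a + ψ b)
    {γ : absoluteGaloisGroup K} (hγ : κ.IsTopGenerator γ) (m : ℕ)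
    (hvan : ∀ σ ∈ κ.layerSubgroup (m + 2), ψ σ = 0) :
    ∀ σ ∈ κ.layerSubgroup 2, ψ σ = 0 := by
  induction m with
  | zero => exact hvan
  | succ m ih =>
    exact ih (addCharOn_eq_zero_of_succ κ hψ hγ (n := m + 1) (by omega)
      (by rw [show m + 1 + 2 = m + 1 + 2 from rfl]; exact hvan))

/-- **An additive character of `L₁` vanishing on `L₂` is a multiple of the layer character**: for
`σ = h·(γ^p)^j ∈ L₁` (`h ∈ L₂`, `exists_layerSubgroup_succ_mul_pow`), `ψ(σ) = j·ψ(γ^p)`.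
[cite: Washington1997, §13.1] -/
theorem addCharOn_eq_mul_of_layer_two {ψ : absoluteGaloisGroup K → ZMod p}
    (hψ : ∀ a ∈ κ.layerSubgroup 1, ∀ b ∈ κ.layerSubgroup 1, ψ (a * b) = ψ a + ψ b)
    {γ : absoluteGaloisGroup K} (hγ : κ.IsTopGenerator γ)
    (hvan : ∀ σ ∈ κ.layerSubgroup 2, ψ σ = 0)
    {σ : absoluteGaloisGroup K} {h : absoluteGaloisGroup K} (hh : h ∈ κ.layerSubgroup 2) {j : ℕ}
    (hσ : σ = h * (γ ^ p) ^ j) : ψ σ = (j : ZMod p) * ψ (γ ^ p) := by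
  have hγ1 : γ ^ p ∈ κ.layerSubgroup 1 := by
    have := pow_mem_layerSubgroup κ hγ 1
    rwa [pow_one] at this
  rw [hσ, hψ _ (κ.layerSubgroup_antitone (by norm_num) hh) _ ((κ.layerSubgroup 1).pow_mem hγ1 j),
    hvan _ hh, zero_add, addCharOn_pow κ hψ hγ1]

/-- **Summary (STEP 2 of F5)**: `ψ` additive on `L₁`, vanishing on some `L_{m+2}`; then for every
`σ ∈ L₁` there are `h ∈ L₂`, `j` with `σ = h(γ^p)^j` and `ψ σ = j·ψ(γ^p)` — `ψ` is determined by the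
single value `ψ(γ^p)`. [cite: Washington1997, §13.1] -/
theorem exists_addCharOn_eq_mul {ψ : absoluteGaloisGroup K → ZMod p}
    (hψ : ∀ a ∈ κ.layerSubgroup 1, ∀ b ∈ κ.layerSubgroup 1, ψ (a * b) = ψ a + ψ b)
    {γ : absoluteGaloisGroup K} (hγ : κ.IsTopGenerator γ) (m : ℕ)
    (hvan : ∀ σ ∈ κ.layerSubgroup (m + 2), ψ σ = 0)
    {σ : absoluteGaloisGroup K} (hσ : σ ∈ κ.layerSubgroup 1) :
    ∃ (h : absoluteGaloisGroup K) (j : ℕ), h ∈ κ.layerSubgroup 2 ∧ σ = h * (γ ^ p) ^ j ∧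
      ψ σ = (j : ZMod p) * ψ (γ ^ p) := by
  obtain ⟨h, j, hj⟩ := κ.exists_layerSubgroup_succ_mul_pow hγ 1 ⟨σ, hσ⟩
  change σ = (h : absoluteGaloisGroup K) * (γ ^ p ^ 1) ^ j at hj
  rw [pow_one] at hj
  exact ⟨h, j, h.2, hj, addCharOn_eq_mul_of_layer_two κ hψ hγ
    (addCharOn_eq_zero_layer_two κ hψ hγ m hvan) h.2 hj⟩

end LayerCharTower

end Summit.BirchSwinnertonDyer.Rank1Residual.Additive
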